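import Literature.MathematicalPhysics.QuantumFieldTheory.Balaban1983to89.B7Prop3GeneralLinearSplit

/-!
# `Balaban1983to89.B7Eq124PrintedGrouping` — T. Bałaban, *Averaging operations for lattice gauge theories*, Commun. Math. Phys.
**98** (1985) 17–51 [Balaban1985Averaging], Sect. D p. 36 [PDF 20]: **(124) IN PRINT'S OWN GROUPING** — the linear part
`(Q(V₀)A)_c` = the main term (125) + the FOUR remainder terms exactly as displayed, each a bracket `[operator − 1]` applied to the
path piece print names — derived from the lineage's regrouped form `B7Prop3GeneralLinearSplit.linQcov_split` by the two operator
identities of p. 35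

statement-level skeleton of published theorems with citation tags; proofs where landed; nothing here is a claim about the Yang–Mills mass gap

PDF held: `paper:balaban1985-cmp98-averaging` (journal page = PDF page + 16); render
`pub-balaban/b2b-balaban-ref1/pages/1985-cmp98-averaging/1985-cmp98-averaging-p020-x2.png` (p. 36) and `-p019-x2.png` (p. 35) read
as images by the typing seat (unit `lit-balaban-r04`, gen 52) and through the verbatim quotations of `B7Prop3GeneralLinearSplit`.

CITATION HEADER / PRINT, verbatim.  p. 35: "We can transform this linear expression using the identities `R(e^{iY_x}) = e^{i ad_{Y_x}}`
and `g⁻¹(−i ad_{Y_x})e^{i ad_{Y_x}} = g⁻¹(i ad_{Y_x})`. […] We have also `(R_{0,c₋}A)(Γ_{c₊,x′}) = R(V₀(c))(R_{0,c₊}A)(Γ_{c₊,x′}) =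
R(e^{−iY})R((V̄₀)_c)(R_{0,c₊}A)(Γ_{c₊,x′}) = e^{−i ad_Y}R̄_{0,c}(R_{0,c₊}A)(Γ_{c₊,x′})`."  p. 36 (124): "`(Q(V₀)A)_c = Σ_{x∈B(c₋)}
L^{−(d+1)}(R_{0,c₋}A)([x, x′]) + Σ_{x∈B(c₋)} L^{−(d+1)}[g(−i ad_Y)g⁻¹(−i ad_{Y_x}) − 1](R_{0,c₋}A)(Γ_{c₋,x}) + Σ_{x∈B(c₋)}
L^{−(d+1)}[g(−i ad_Y)g⁻¹(−i ad_{Y_x}) − 1]·(R_{0,c₋}A)([x, x′]) − Σ_{x∈B(c₋)} L^{−(d+1)}·[g(−i ad_Y)g⁻¹(i ad_{Y_x})e^{−i ad_Y} − 1]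
R̄_{0,c}(R_{0,c₊}A)(Γ_{c₊,x′}) + [e^{i ad_Y} − g(−i ad_Y) Σ_{x∈B(c₋)} L^{−d}g⁻¹(i ad_{Y_x})]L⁻¹(R_{0,c₋}A)(c).` (124)  The first term on the
right-hand side above is the main term in this linear form, and it resembles the definition of the averaging operation `Q` in [2].
We will denote the main term by `Q_{V₀}`, or `Q₀` […] (125)  The remaining terms are small because the functions `g(−z)`, `g⁻¹(z)`,
`e^{iz}` are equal to `1` for `z = 0`".

DICTIONARY (files 1–4 of the lineage's Prop. 3 row; the `i`'s absorbed).  `X₀ := X_c(V₀) = Xavg L V₀ q κ` (= `iY`);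
`W_x := Wcx L V₀ q κ r` (= `e^{iY_x}`, `x = q + r`); `Φ := PhiY X₀` (= `g(−i ad_Y)`); `Z ↦ Dmlog W_x (Z·W_x)` (= `g⁻¹(−i ad_{Y_x})`);
`PsiW W_x` = `Z ↦ Dmlog W_x (W_x·Z)` (= `g⁻¹(i ad_{Y_x})`); `𝒜 := conjR (expUnit X₀)` (= `e^{i ad_Y} = R(e^{iY})`); `conjR (expUnit X₀)⁻¹`
(= `e^{−i ad_Y}`); `R̄_{0,c} = conjR (bavg L V₀ q κ)`; `(R_{0,c₋}A)(Γ_{c₋,x}) = tsum V₀ A q (treeWord r)`; `(R_{0,c₋}A)([x, x′])` (print's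
notation for the `c₋`-rotated segment piece of `(R_{0,c₋}A)(Γ_{c₋,x}∪[x,x′])`) `= conjR (hol V₀ q (treeWord r)) (tsum V₀ A (q + r) (seg κ L))`;
`(R_{0,c₊}A)(Γ_{c₊,x′}) = tsum V₀ A (q + Le_κ) (treeWord r)`; `(R_{0,c₋}A)(c) = tsum V₀ A q (seg κ L)`; the linear part «L(Q(V₀)A)_c» =
`linQcov L V₀ A q κ` and the main term `L·(Q₀A)_c = L • Q0cov` (READING C-adv4-22: the lineage's `Qcov` is `L` times print's
`(Q(V₀)A)_c`, so every weight `L^{−(d+1)}` of (124) appears here as `L^{−d}` and `L⁻¹(R_{0,c₋}A)(c)` as `(R_{0,c₋}A)(c)`).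

WHAT THIS FILE PROVES (kernel, 0 sorry, standard axioms; no definitions, no `def … : Prop`).
* §1 the two identities of p. 35 in the lineage's operators: `Dmlog_conjR_mul` ("`g⁻¹(−i ad_{Y_x})e^{i ad_{Y_x}} = g⁻¹(i ad_{Y_x})`":
  `Dmlog W (R(W)Z·W) = PsiW W Z`) and `conjR_expUnit_inv_bavg` ("`R(V₀(c)) = e^{−i ad_Y}R̄_{0,c}`").
* §2 **`linQcov_eq124`** — (124) TERM BY TERM in print's grouping (times `L`), and **`eq124_verbatim`** (divided by `L`: print's
  weights `L^{−(d+1)}` and `L⁻¹(R_{0,c₋}A)(c)`): `L(Q(V₀)A)_c = L·(Q₀A)_c + Σ_x L^{−d}[ΦΨ_x − 1]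
  (R_{0,c₋}A)(Γ_{c₋,x}) + Σ_x L^{−d}[ΦΨ_x − 1](R_{0,c₋}A)([x,x′]) − Σ_x L^{−d}[ΦΨ′_x e^{−i ad_Y} − 1]R̄_{0,c}(R_{0,c₊}A)(Γ_{c₊,x′}) +
  [e^{i ad_Y} − Φ Σ_x L^{−d}Ψ′_x](R_{0,c₋}A)(c)`, under the small-field condition `‖W_x(V₀) − 1‖ < 1` on `B(c₋)` inherited from
  `B7Prop3GeneralTild.linQcov_eq` (closes the NOT-CERTIFIED item "the term-by-term identification with print's grouping of (124)" of
  `B7Prop3GeneralLinearSplit`).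
Owner audit context: ROWS-B7 row `B7.Eq121` ((121)–(125)); this member puts display (124) in the tree as printed.  Unit
`lit-balaban-r04` gen 52, 2026-08-23.
-/

noncomputable section

open scoped BigOperators
open NormedSpace Finset

namespace Literature.MathematicalPhysics.QuantumFieldTheory.Balaban1983to89.B7Eq124PrintedGrouping

open B7Prop1Explicit B7Prop3Flat B7Eq92Concrete MatrixLog B7Prop3GeneralRotated B7Prop3GeneralLinear
  B7Prop3GeneralTild B7Prop3GeneralLinearSplit
open B7Eq78Linearization (conjR conjR_apply conjR_add conjR_sub conjR_smul conjR_smul_real conjR_one)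
open B12AverageCorridor267 (Dmlog PhiY PsiW PsiW_apply)

-- `Site` alone would resolve to the torus sites of `Setup.lean`; re-export the `ℤ^d` sites of `B7Prop1Explicit`.
export B7Prop1Explicit (Site)

variable {d : ℕ}

variable {𝔸 : Type*} [NormedRing 𝔸] [NormedAlgebra ℂ 𝔸] [NormOneClass 𝔸] [CompleteSpace 𝔸]
variable (L : ℕ)

/-! ## §1 The two operator identities of p. 35 -/

omit [NormOneClass 𝔸] [CompleteSpace 𝔸] in
/-- **p. 35: "`g⁻¹(−i ad_{Y_x})e^{i ad_{Y_x}} = g⁻¹(i ad_{Y_x})`"** in the lineage's operators: `(D log)_W(R(W)Z · W) = (D log)_W(W·Z)`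
`= PsiW W Z`, because `R(W)Z·W = WZW⁻¹W = WZ`. [cite: Balaban1985Averaging, p.35 (text after (117))] -/
theorem Dmlog_conjR_mul (W : 𝔸ˣ) (Z : 𝔸) : Dmlog (W : 𝔸) (conjR W Z * W) = PsiW (W : 𝔸) Z := by
  rw [PsiW_apply, conjR_apply, Units.inv_mul_cancel_right]

omit [NormedAlgebra ℂ 𝔸] [NormOneClass 𝔸] [CompleteSpace 𝔸] in
/-- `R(1) = id`. [cite: Balaban1985Averaging, (56) p.27] -/
private theorem conjR_one_left (Z : 𝔸) : conjR (1 : 𝔸ˣ) Z = Z := by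
  simp [conjR_apply]

omit [NormOneClass 𝔸] in
/-- **p. 35: "`R(V₀(c)) = R(e^{−iY})R((V̄₀)_c) = e^{−i ad_Y}R̄_{0,c}`"**: `R(e^{X₀})⁻¹ ∘ R̄_{0,c} = R(V₀(c))` (`(V̄₀)_c = e^{X₀}V₀(c)`,
(42)). [cite: Balaban1985Averaging, p.35 (text before (118)), (42) p.23] -/
theorem conjR_expUnit_inv_bavg (V₀ : Site d → Fin d → 𝔸ˣ) (q : Site d) (κ : Fin d) (G : 𝔸) :
    conjR (expUnit (Xavg L V₀ q κ))⁻¹ (conjR (bavg L V₀ q κ) G) = conjR (hol V₀ q (seg κ L)) G := by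
  rw [conjR_bavg, ← conjR_mul_left, inv_mul_cancel, conjR_one_left]

/-! ## §2 (124) in print's grouping -/

omit [NormOneClass 𝔸] [CompleteSpace 𝔸] in
/-- a continuous `ℂ`-linear operator through a finite sum of REAL multiples. [folklore] -/
private theorem clm_sum_smul {ι : Type*} (s : Finset ι) (T : 𝔸 →L[ℂ] 𝔸) (w : ℝ) (f : ι → 𝔸) :
    T (∑ i ∈ s, w • f i) = ∑ i ∈ s, w • T (f i) := by
  rw [map_sum]
  refine Finset.sum_congr rfl fun i _ => ?_
  exact T.map_smul_of_tower w (f i)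

/-- **(124) IN PRINT'S GROUPING** (times `L`, READING C-adv4-22).  Under the small-field condition `‖W_x(V₀) − 1‖ < 1` on the block
`B(c₋)`, with `X₀ = X_c(V₀)`, `W_x = V₀(Γ_{c,x}∪(−c))`, `Φ = PhiY X₀` (`g(−i ad_Y)`), `Z ↦ Dmlog W_x (Z W_x)` (`g⁻¹(−i ad_{Y_x})`),
`PsiW W_x` (`g⁻¹(i ad_{Y_x})`), `conjR (expUnit X₀)^{±1}` (`e^{±i ad_Y}`), `R̄_{0,c} = conjR (bavg L V₀ q κ)`:
`L(Q(V₀)A)_c = L·(Q₀A)_c`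
`  + Σ_x L^{−d}[g(−i ad_Y)g⁻¹(−i ad_{Y_x}) − 1](R_{0,c₋}A)(Γ_{c₋,x})`
`  + Σ_x L^{−d}[g(−i ad_Y)g⁻¹(−i ad_{Y_x}) − 1](R_{0,c₋}A)([x, x′])`
`  − Σ_x L^{−d}[g(−i ad_Y)g⁻¹(i ad_{Y_x})e^{−i ad_Y} − 1]R̄_{0,c}(R_{0,c₊}A)(Γ_{c₊,x′})`
`  + [e^{i ad_Y} − g(−i ad_Y)Σ_x L^{−d}g⁻¹(i ad_{Y_x})](R_{0,c₋}A)(c)` — the five terms of (124) in print's order and grouping.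
[cite: Balaban1985Averaging, (124) p.36, p.35 (identities), (115) p.34, (120) p.35] -/
theorem linQcov_eq124 (hL : 1 ≤ L) (V₀ : Site d → Fin d → 𝔸ˣ) (A : Site d → Fin d → 𝔸) (q : Site d) (κ : Fin d)
    (hW : ∀ r : Fin d → Fin L, ‖((Wcx L V₀ q κ (boxVec L r) : 𝔸ˣ) : 𝔸) - 1‖ < 1) :
    linQcov L V₀ A q κ
      = (L : ℝ) • Q0cov L V₀ A q κ
        + ∑ r : Fin d → Fin L, (((L : ℝ) ^ d)⁻¹) •
            (PhiY (Xavg L V₀ q κ)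
                (Dmlog ((Wcx L V₀ q κ (boxVec L r) : 𝔸ˣ) : 𝔸)
                  (tsum V₀ A q (treeWord (boxVec L r)) * ((Wcx L V₀ q κ (boxVec L r) : 𝔸ˣ) : 𝔸)))
              - tsum V₀ A q (treeWord (boxVec L r)))
        + ∑ r : Fin d → Fin L, (((L : ℝ) ^ d)⁻¹) •
            (PhiY (Xavg L V₀ q κ)
                (Dmlog ((Wcx L V₀ q κ (boxVec L r) : 𝔸ˣ) : 𝔸)
                  (conjR (hol V₀ q (treeWord (boxVec L r))) (tsum V₀ A (q + boxVec L r) (seg κ L))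
                    * ((Wcx L V₀ q κ (boxVec L r) : 𝔸ˣ) : 𝔸)))
              - conjR (hol V₀ q (treeWord (boxVec L r))) (tsum V₀ A (q + boxVec L r) (seg κ L)))
        - ∑ r : Fin d → Fin L, (((L : ℝ) ^ d)⁻¹) •
            (PhiY (Xavg L V₀ q κ)
                (PsiW ((Wcx L V₀ q κ (boxVec L r) : 𝔸ˣ) : 𝔸)
                  (conjR (expUnit (Xavg L V₀ q κ))⁻¹
                    (conjR (bavg L V₀ q κ) (tsum V₀ A (q + (L : ℤ) • e κ) (treeWord (boxVec L r))))))
              - conjR (bavg L V₀ q κ) (tsum V₀ A (q + (L : ℤ) • e κ) (treeWord (boxVec L r))))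
        + (conjR (expUnit (Xavg L V₀ q κ)) (tsum V₀ A q (seg κ L))
            - PhiY (Xavg L V₀ q κ)
                (∑ r : Fin d → Fin L, (((L : ℝ) ^ d)⁻¹) •
                  PsiW ((Wcx L V₀ q κ (boxVec L r) : 𝔸ˣ) : 𝔸) (tsum V₀ A q (seg κ L)))) := by
  rw [linQcov_split L hL V₀ A q κ hW]
  unfold DXavg
  simp_rw [conjR_expUnit_inv_bavg, conjR_bavg, Aloop_eq, conjR_gammaWord]
  simp only [sub_mul, add_mul, map_sub, map_add, Dmlog_conjR_mul, clm_sum_smul, smul_add, smul_sub,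
    Finset.sum_add_distrib, Finset.sum_sub_distrib]
  abel

/-- **(124) VERBATIM (print's weights)**: dividing `linQcov_eq124` by `L` — `(Q(V₀)A)_c = L⁻¹·L(Q(V₀)A)_c` equals the main term
(125) `(Q₀A)_c = Σ_x L^{−(d+1)}(R_{0,c₋}A)([x, x′])` (`Q0cov`) plus the four remainder terms with the printed weights `L^{−(d+1)}`,
`L^{−(d+1)}`, `L^{−(d+1)}`, and `[e^{i ad_Y} − g(−i ad_Y)Σ_x L^{−d}g⁻¹(i ad_{Y_x})]` applied to `L⁻¹(R_{0,c₋}A)(c)`.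
[cite: Balaban1985Averaging, (124)–(125) p.36] -/
theorem eq124_verbatim (hL : 1 ≤ L) (V₀ : Site d → Fin d → 𝔸ˣ) (A : Site d → Fin d → 𝔸) (q : Site d) (κ : Fin d)
    (hW : ∀ r : Fin d → Fin L, ‖((Wcx L V₀ q κ (boxVec L r) : 𝔸ˣ) : 𝔸) - 1‖ < 1) :
    (L : ℝ)⁻¹ • linQcov L V₀ A q κ
      = Q0cov L V₀ A q κ
        + ∑ r : Fin d → Fin L, (((L : ℝ) ^ (d + 1))⁻¹) •
            (PhiY (Xavg L V₀ q κ)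
                (Dmlog ((Wcx L V₀ q κ (boxVec L r) : 𝔸ˣ) : 𝔸)
                  (tsum V₀ A q (treeWord (boxVec L r)) * ((Wcx L V₀ q κ (boxVec L r) : 𝔸ˣ) : 𝔸)))
              - tsum V₀ A q (treeWord (boxVec L r)))
        + ∑ r : Fin d → Fin L, (((L : ℝ) ^ (d + 1))⁻¹) •
            (PhiY (Xavg L V₀ q κ)
                (Dmlog ((Wcx L V₀ q κ (boxVec L r) : 𝔸ˣ) : 𝔸)
                  (conjR (hol V₀ q (treeWord (boxVec L r))) (tsum V₀ A (q + boxVec L r) (seg κ L))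
                    * ((Wcx L V₀ q κ (boxVec L r) : 𝔸ˣ) : 𝔸)))
              - conjR (hol V₀ q (treeWord (boxVec L r))) (tsum V₀ A (q + boxVec L r) (seg κ L)))
        - ∑ r : Fin d → Fin L, (((L : ℝ) ^ (d + 1))⁻¹) •
            (PhiY (Xavg L V₀ q κ)
                (PsiW ((Wcx L V₀ q κ (boxVec L r) : 𝔸ˣ) : 𝔸)
                  (conjR (expUnit (Xavg L V₀ q κ))⁻¹
                    (conjR (bavg L V₀ q κ) (tsum V₀ A (q + (L : ℤ) • e κ) (treeWord (boxVec L r))))))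
              - conjR (bavg L V₀ q κ) (tsum V₀ A (q + (L : ℤ) • e κ) (treeWord (boxVec L r))))
        + (conjR (expUnit (Xavg L V₀ q κ)) ((L : ℝ)⁻¹ • tsum V₀ A q (seg κ L))
            - PhiY (Xavg L V₀ q κ)
                (∑ r : Fin d → Fin L, (((L : ℝ) ^ d)⁻¹) •
                  PsiW ((Wcx L V₀ q κ (boxVec L r) : 𝔸ˣ) : 𝔸) ((L : ℝ)⁻¹ • tsum V₀ A q (seg κ L)))) := by
  have hL0 : (L : ℝ) ≠ 0 := by exact_mod_cast (by omega : L ≠ 0)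
  have hw : ∀ Z : 𝔸, (L : ℝ)⁻¹ • ((((L : ℝ) ^ d)⁻¹) • Z) = (((L : ℝ) ^ (d + 1))⁻¹) • Z := by
    intro Z
    rw [smul_smul, pow_succ, mul_inv, mul_comm]
  -- pull the factor `L⁻¹` out of the operators in the last term
  have hlast : conjR (expUnit (Xavg L V₀ q κ)) ((L : ℝ)⁻¹ • tsum V₀ A q (seg κ L))
        - PhiY (Xavg L V₀ q κ)
            (∑ r : Fin d → Fin L, (((L : ℝ) ^ d)⁻¹) •
              PsiW ((Wcx L V₀ q κ (boxVec L r) : 𝔸ˣ) : 𝔸) ((L : ℝ)⁻¹ • tsum V₀ A q (seg κ L)))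
      = (L : ℝ)⁻¹ • (conjR (expUnit (Xavg L V₀ q κ)) (tsum V₀ A q (seg κ L))
          - PhiY (Xavg L V₀ q κ)
              (∑ r : Fin d → Fin L, (((L : ℝ) ^ d)⁻¹) •
                PsiW ((Wcx L V₀ q κ (boxVec L r) : 𝔸ˣ) : 𝔸) (tsum V₀ A q (seg κ L)))) := by
    rw [smul_sub, conjR_smul_real, ← ContinuousLinearMap.map_smul_of_tower, Finset.smul_sum]
    congr 2
    refine Finset.sum_congr rfl fun r _ => ?_
    rw [ContinuousLinearMap.map_smul_of_tower, smul_comm]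
  rw [hlast, linQcov_eq124 L hL V₀ A q κ hW]
  simp only [smul_add, smul_sub, Finset.smul_sum, hw, smul_smul (L : ℝ)⁻¹ (L : ℝ), inv_mul_cancel₀ hL0, one_smul]

end Literature.MathematicalPhysics.QuantumFieldTheory.Balaban1983to89.B7Eq124PrintedGrouping
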